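import Literature.NumberTheory.Automorphic.LevelTwoInteriorOrbitalTransport      -- ★ p846692 N3 (F0P2-p01): `classOrbitalIntegral_levelOneIndicator_eq_shift`
import Literature.NumberTheory.Rogawski1990.FinExplicitTransferFactorCayleyShiftSum  -- ★ p846531 (A3) (F0P2-p02): `finsum_finExplicitCollection_Δ_mul_eq_inv_sq_mul_finsum_shift`
import HarnessLib

/-!
# The LIFT's interior half, trunk: the `Δ‴`-weighted interior orbital sum under the Cayley shift (organ (I), Rogawski §4.9 Prop. 4.9.1 (b))

For `L∕L⁺` CM, `v` non-split unramified, `H′_w` unimodular: let `g` be a level-2 `K`-class piece on `G′_v = U(H′)(L⁺_v)`, `g_int =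
1_{x_w ≡ 1 (ϖ_v)}·g` its interior part, `g′` a level-1 strata piece with the interior values `c′` of `g` (organ V), `γ_H` a
`G`-regular 2-deep element of the endoscopic carrier and `u_H = φ_c(γ_H)` its Cayley shift (`c_w = ϖ_v`).  The type-free TRUNK of
organ (I): the transport ★ (A3) `Σᶠ_c Δ‴(γ_H,c)·F(c) = q_v⁻²·Σᶠ_c Δ‴(u_H,c)·F′(c)` holds with `F = Φ(·, g_int)`, `F′ = Φ(·, g′)` because
its class-function socket `hF` is exactly ★ N3 `classOrbitalIntegral_levelOneIndicator_eq_shift` (`Φ(⟦x⟧, g_int) = Φ(⟦φ_c x⟧, g′)` on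
norm pairs of `γ_H`).  What remains per torus type (the branches) is only the production of the binders (`u_H` regular, the depth drop
`hm`, compact centralisers) and the two `S`-rows.

**Main result.** `finsum_delta_mul_classOrbitalIntegral_levelOneIndicator_eq_inv_sq_mul_shift`.

The print: [Rogawski1990] §4.9 Prop. 4.9.1 (b) p. 55 (`Φ(γ, f)` for `γ → 1` along the shift), §4.3 (4.3.1) p. 43; [Kottwitz1986] §3.

## References
* [Rogawski1990] J. Rogawski, *Automorphic Representations of Unitary Groups in Three Variables*, Ann. of Math. Stud. 123 (1990),
  §4.9 Prop. 4.9.1 p. 55; §4.3 p. 43.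
* [Kottwitz1986] R. Kottwitz, *Base change for unit elements of Hecke algebras*, Compositio Math. 60 (1986), §3.
-/

set_option autoImplicit false

noncomputable section

open NumberField IsDedekindDomain Matrix Polynomial MeasureTheory Measure Topology Filter
open scoped MatrixGroups WithZero Valued

namespace Literature.NumberTheory.Automorphic

open UnitaryGroup Literature.NumberTheory.Rogawski1990 Literature.NumberTheory.Automorphic.MoebiusShift Literature.NumberTheory.Automorphic.IntegralReduction
  Literature.NumberTheory.GaloisRepresentations Literature.NumberTheory.NumberFields

set_option maxHeartbeats 800000 in
-- budget only: one statement-heavy declaration (the (A3) + N3 binders); the proof is a single application.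
/-- **TRUNK of organ (I): the `Δ‴`-weighted interior orbital sum transports under the Cayley shift** — for a `G`-regular 2-deep `γ_H`
with shift `u_H = φ_c(γ_H)` (componentwise matrix identities `h1 h2'`, denominators `hD1 hD2 hD hN hμ₂` units, depth drop `hm`, compact
centralisers along both matching classes `hZ hZ'`), a level-2 `K`-class piece `g` with interior values `c′` and a level-1 strata piece `g′`
with values `c′`: `Σᶠ_c Δ‴(γ_H,c)·Φ(c, g_int) = q_v⁻²·Σᶠ_c Δ‴(u_H,c)·Φ(c, g′)` — ★ (A3) `finsum_finExplicitCollection_Δ_mul_eq_inv_sq_mul_finsum_shift`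
with `hF :=` ★ N3 `classOrbitalIntegral_levelOneIndicator_eq_shift`. [cite: Rogawski1990, §4.9 Prop. 4.9.1 (b) p. 55; §4.3 p. 43] [cite: Kottwitz1986, §3] -/
theorem finsum_delta_mul_classOrbitalIntegral_levelOneIndicator_eq_inv_sq_mul_shift (L : Type) [Field L] [NumberField L] [IsCMField L] (H' : Matrix (Fin 3) (Fin 3) L)
    {v : HeightOneSpectrum (𝓞 ↥(maximalRealSubfield L))}
    (hH' : (H'.map (cmConjRingHom L)).transpose = H') (hdet : H'.det ≠ 0) (w : UnitaryGroup.PlacesOver L v)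
    (hw : IsCMField.complexConj L • w.1 = w.1) (hv : Algebra.IsUnramifiedIn (𝓞 L) v.asIdeal)
    (h2 : Valued.v (2 : w.1.adicCompletion L) = 1)
    [MeasurableSpace ((cmDatum L 3 H').Local v)] [BorelSpace ((cmDatum L 3 H').Local v)]
    [∀ γ : ((cmDatum L 3 H').Local v), MeasurableSpace (((cmDatum L 3 H').Local v) ⧸ Subgroup.centralizer ({γ} : Set ((cmDatum L 3 H').Local v)))]
    [∀ γ : ((cmDatum L 3 H').Local v), BorelSpace (((cmDatum L 3 H').Local v) ⧸ Subgroup.centralizer ({γ} : Set ((cmDatum L 3 H').Local v)))]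
    (νG : Measure ((cmDatum L 3 H').Local v)) [νG.IsHaarMeasure] [νG.IsMulRightInvariant] {mG : OrbitalMeasureFamily ((cmDatum L 3 H').Local v)}
    (hmG : mG.IsCanonical (fun γ => IsRegularElt (γ.val : GL (Fin 3) (UnitaryGroup.LocalRing L v))) νG)
    (μ : HeckeCharacter L) (hμ : μ.IsUnramifiedAt w.1)
    (hμω : ∀ x : ideleGroup ↥(maximalRealSubfield L), μ (AdeleRing.ideleBaseChange ↥(maximalRealSubfield L) L x) = quadraticHeckeCharCM L x)
    (c : LocalRing L v)
    (hcw : c w = toPlace v w (HeckeCharacter.uniformizer ↥(maximalRealSubfield L) v : v.adicCompletion ↥(maximalRealSubfield L)))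
    (hσc : conjLocal L (IsCMField.complexConj L) v c = c) (h4c : IsUnit ((c + 1) ^ 2 - (c - 1) ^ 2))
    (γH uH : (cmDatum L 2 (Matrix.of fun i j : Fin 2 => if i.val + j.val + 1 = 2 then (1 : L) else 0)).Local v ×
      (cmDatum L 1 (Matrix.of fun i j : Fin 1 => if i.val + j.val + 1 = 1 then (1 : L) else 0)).Local v)
    (hreg : IsLocalGRegular L v γH) (hreg' : IsLocalGRegular L v uH)
    (h1 : ((uH.1.val : GL (Fin 2) (LocalRing L v)).val : Matrix (Fin 2) (Fin 2) (LocalRing L v)) =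
      ((c + 1) • ((γH.1.val : GL (Fin 2) (LocalRing L v)).val : Matrix (Fin 2) (Fin 2) (LocalRing L v)) + (c - 1) • 1) *
        ((c - 1) • ((γH.1.val : GL (Fin 2) (LocalRing L v)).val : Matrix (Fin 2) (Fin 2) (LocalRing L v)) + (c + 1) • 1)⁻¹)
    (h2' : ((uH.2.val : GL (Fin 1) (LocalRing L v)).val : Matrix (Fin 1) (Fin 1) (LocalRing L v)) =
      ((c + 1) • ((γH.2.val : GL (Fin 1) (LocalRing L v)).val : Matrix (Fin 1) (Fin 1) (LocalRing L v)) + (c - 1) • 1) *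
        ((c - 1) • ((γH.2.val : GL (Fin 1) (LocalRing L v)).val : Matrix (Fin 1) (Fin 1) (LocalRing L v)) + (c + 1) • 1)⁻¹)
    (hD1 : IsUnit ((c - 1) • ((γH.1.val : GL (Fin 2) (LocalRing L v)).val : Matrix (Fin 2) (Fin 2) (LocalRing L v)) + (c + 1) • (1 : Matrix (Fin 2) (Fin 2) (LocalRing L v))).det)
    (hD2 : IsUnit ((c - 1) • ((γH.2.val : GL (Fin 1) (LocalRing L v)).val : Matrix (Fin 1) (Fin 1) (LocalRing L v)) + (c + 1) • (1 : Matrix (Fin 1) (Fin 1) (LocalRing L v))).det)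
    (hD : IsUnit ((c - 1) • (((endoEmbLocal L v γH).val : GL (Fin 3) (LocalRing L v)).val : Matrix (Fin 3) (Fin 3) (LocalRing L v)) +
      (c + 1) • (1 : Matrix (Fin 3) (Fin 3) (LocalRing L v))).det)
    (hN : IsUnit ((c + 1) • (((endoEmbLocal L v γH).val : GL (Fin 3) (LocalRing L v)).val : Matrix (Fin 3) (Fin 3) (LocalRing L v)) +
      (c - 1) • (1 : Matrix (Fin 3) (Fin 3) (LocalRing L v))).det)
    (hμ₂ : IsUnit ((c - 1) * finGammaTwo L v γH + (c + 1)))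
    (hm : WithZero.log (Valued.v (((finCharpolyTwo L v uH).eval (finGammaTwo L v uH)) w)) =
      WithZero.log (Valued.v (((finCharpolyTwo L v γH).eval (finGammaTwo L v γH)) w)) + 2)
    (hdeep : ∀ i j, Valued.v (((((endoEmbLocal L v γH).val : GL (Fin 3) (LocalRing L v)).val.map
        (Pi.evalRingHom (fun w' : UnitaryGroup.PlacesOver L v => w'.1.adicCompletion L) w)) - 1) i j) ≤ Valued.v (c w) ^ 2)
    (hZ : ∀ x : (cmDatum L 3 H').Local v, IsLocalNormPair L H' v γH x → CompactSpace (Subgroup.centralizer ({x} : Set ((cmDatum L 3 H').Local v))))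
    (hZ' : ∀ y : (cmDatum L 3 H').Local v, IsLocalNormPair L H' v uH y → CompactSpace (Subgroup.centralizer ({y} : Set ((cmDatum L 3 H').Local v))))
    (g : ((cmDatum L 3 H').Local v) → ℂ) (hg : Rogawski1990.IsLocSmooth g) (hgK : tsupport g ⊆ (cmLocalIntegralLevel L 3 H' v : Set ((cmDatum L 3 H').Local v)))
    (hginv : ∀ u ∈ cmLocalIntegralLevel L 3 H' v, ∀ x, g (u * x * u⁻¹) = g x)
    (c' : ℕ → ℂ) (hc' : ((∀ x : ((cmDatum L 3 H').Local v), (x ∈ cmLocalIntegralLevel L 3 H' v ∧ (∀ a b, Valued.v (((toPlace v w (HeckeCharacter.uniformizer ↥(maximalRealSubfield L) v : v.adicCompletion ↥(maximalRealSubfield L))) ^ 1)⁻¹ *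
        ((((localNonsplitEquiv (IsCMField.complexConj L) H' (IsCMField.complexConj_ne_one L) w hw (x) :
            ↥(unitaryGroupOfForm (galAdicCompletionMap (L := L) (IsCMField.complexConj L) hw) (placeForm H' w.1))) : GL (Fin 3) (w.1.adicCompletion L)) :
              Matrix (Fin 3) (Fin 3) (w.1.adicCompletion L)) a b - (1 : Matrix (Fin 3) (Fin 3) (w.1.adicCompletion L)) a b)) ≤ 1) ∧
        (redMat ((toPlace v w (HeckeCharacter.uniformizer ↥(maximalRealSubfield L) v : v.adicCompletion ↥(maximalRealSubfield L)))⁻¹ • ((((x).val : GL (Fin 3) (UnitaryGroup.LocalRing L v)).val.map (Pi.evalRingHom (fun w' : UnitaryGroup.PlacesOver L v => w'.1.adicCompletion L) w)) - 1))) ^ 3 = 0 ∧ (redMat ((toPlace v w (HeckeCharacter.uniformizer ↥(maximalRealSubfield L) v : v.adicCompletion ↥(maximalRealSubfield L)))⁻¹ • ((((x).val : GL (Fin 3) (UnitaryGroup.LocalRing L v)).val.map (Pi.evalRingHom (fun w' : UnitaryGroup.PlacesOver L v => w'.1.adicCompletion L) w)) - 1))).rank = 0) → g x = c' 0) ∧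
      (∀ x : ((cmDatum L 3 H').Local v), (x ∈ cmLocalIntegralLevel L 3 H' v ∧ (∀ a b, Valued.v (((toPlace v w (HeckeCharacter.uniformizer ↥(maximalRealSubfield L) v : v.adicCompletion ↥(maximalRealSubfield L))) ^ 1)⁻¹ *
        ((((localNonsplitEquiv (IsCMField.complexConj L) H' (IsCMField.complexConj_ne_one L) w hw (x) :
            ↥(unitaryGroupOfForm (galAdicCompletionMap (L := L) (IsCMField.complexConj L) hw) (placeForm H' w.1))) : GL (Fin 3) (w.1.adicCompletion L)) :
              Matrix (Fin 3) (Fin 3) (w.1.adicCompletion L)) a b - (1 : Matrix (Fin 3) (Fin 3) (w.1.adicCompletion L)) a b)) ≤ 1) ∧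
        (redMat ((toPlace v w (HeckeCharacter.uniformizer ↥(maximalRealSubfield L) v : v.adicCompletion ↥(maximalRealSubfield L)))⁻¹ • ((((x).val : GL (Fin 3) (UnitaryGroup.LocalRing L v)).val.map (Pi.evalRingHom (fun w' : UnitaryGroup.PlacesOver L v => w'.1.adicCompletion L) w)) - 1))) ^ 3 = 0 ∧ (redMat ((toPlace v w (HeckeCharacter.uniformizer ↥(maximalRealSubfield L) v : v.adicCompletion ↥(maximalRealSubfield L)))⁻¹ • ((((x).val : GL (Fin 3) (UnitaryGroup.LocalRing L v)).val.map (Pi.evalRingHom (fun w' : UnitaryGroup.PlacesOver L v => w'.1.adicCompletion L) w)) - 1))).rank = 1) → g x = c' 1) ∧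
      (∀ x : ((cmDatum L 3 H').Local v), (x ∈ cmLocalIntegralLevel L 3 H' v ∧ (∀ a b, Valued.v (((toPlace v w (HeckeCharacter.uniformizer ↥(maximalRealSubfield L) v : v.adicCompletion ↥(maximalRealSubfield L))) ^ 1)⁻¹ *
        ((((localNonsplitEquiv (IsCMField.complexConj L) H' (IsCMField.complexConj_ne_one L) w hw (x) :
            ↥(unitaryGroupOfForm (galAdicCompletionMap (L := L) (IsCMField.complexConj L) hw) (placeForm H' w.1))) : GL (Fin 3) (w.1.adicCompletion L)) :
              Matrix (Fin 3) (Fin 3) (w.1.adicCompletion L)) a b - (1 : Matrix (Fin 3) (Fin 3) (w.1.adicCompletion L)) a b)) ≤ 1) ∧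
        (redMat ((toPlace v w (HeckeCharacter.uniformizer ↥(maximalRealSubfield L) v : v.adicCompletion ↥(maximalRealSubfield L)))⁻¹ • ((((x).val : GL (Fin 3) (UnitaryGroup.LocalRing L v)).val.map (Pi.evalRingHom (fun w' : UnitaryGroup.PlacesOver L v => w'.1.adicCompletion L) w)) - 1))) ^ 3 = 0 ∧ (redMat ((toPlace v w (HeckeCharacter.uniformizer ↥(maximalRealSubfield L) v : v.adicCompletion ↥(maximalRealSubfield L)))⁻¹ • ((((x).val : GL (Fin 3) (UnitaryGroup.LocalRing L v)).val.map (Pi.evalRingHom (fun w' : UnitaryGroup.PlacesOver L v => w'.1.adicCompletion L) w)) - 1))).rank = 2) → g x = c' 2)))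
    (g' : ((cmDatum L 3 H').Local v) → ℂ) (hg' : Rogawski1990.IsLocSmooth g') (hg'K : tsupport g' ⊆ (cmLocalIntegralLevel L 3 H' v : Set ((cmDatum L 3 H').Local v)))
    (hg'inv : ∀ u ∈ cmLocalIntegralLevel L 3 H' v, ∀ x, g' (u * x * u⁻¹) = g' x)
    (hg'val : ∀ k ∈ cmLocalIntegralLevel L 3 H' v,
        (redMat (((k).val : GL (Fin 3) (UnitaryGroup.LocalRing L v)).val.map (Pi.evalRingHom (fun w' : UnitaryGroup.PlacesOver L v => w'.1.adicCompletion L) w)) - 1) ^ 3 = 0 →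
        g' k = c' (redMat (((k).val : GL (Fin 3) (UnitaryGroup.LocalRing L v)).val.map (Pi.evalRingHom (fun w' : UnitaryGroup.PlacesOver L v => w'.1.adicCompletion L) w)) - 1).rank) :
    (∑ᶠ cG : ConjClasses ((cmDatum L 3 H').Local v),
        ((finExplicitCollection L H' μ (finExplicitDelta_conj_left_all L H' μ) (finExplicitDelta_conj_right_all L H' μ)) v).Δ γH (Quotient.out cG) *
          classOrbitalIntegral mG ({x : (cmDatum L 3 H').Local v | (∀ a b, Valued.v (((toPlace v w (HeckeCharacter.uniformizer ↥(maximalRealSubfield L) v : v.adicCompletion ↥(maximalRealSubfield L))) ^ 1)⁻¹ *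
        ((((localNonsplitEquiv (IsCMField.complexConj L) H' (IsCMField.complexConj_ne_one L) w hw (x) :
            ↥(unitaryGroupOfForm (galAdicCompletionMap (L := L) (IsCMField.complexConj L) hw) (placeForm H' w.1))) : GL (Fin 3) (w.1.adicCompletion L)) :
              Matrix (Fin 3) (Fin 3) (w.1.adicCompletion L)) a b - (1 : Matrix (Fin 3) (Fin 3) (w.1.adicCompletion L)) a b)) ≤ 1)}.indicator g) cG) =
      (((Ideal.absNorm v.asIdeal : ℕ) : ℂ) ^ 2)⁻¹ *
        (∑ᶠ cG : ConjClasses ((cmDatum L 3 H').Local v),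
          ((finExplicitCollection L H' μ (finExplicitDelta_conj_left_all L H' μ) (finExplicitDelta_conj_right_all L H' μ)) v).Δ uH (Quotient.out cG) * classOrbitalIntegral mG g' cG) :=
  finsum_finExplicitCollection_Δ_mul_eq_inv_sq_mul_finsum_shift L v H' w hw c γH uH μ hμω hv hμ hσc h4c hreg hreg' h1 h2' hD1 hD2 hD hN hμ₂ hm _ _
    fun x y hx hy => classOrbitalIntegral_levelOneIndicator_eq_shift L H' hH' hdet w hw hv h2 νG hmG c hcw γH uH hreg hreg' h1 h2' hD1 hD2
      hdeep hZ hZ' g hg hgK hginv c' hc' g' hg' hg'K hg'inv hg'val x y hx hy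

end Literature.NumberTheory.Automorphic
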